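import Summits.RiemannHypothesis.RiemannHypothesis.Theorems.HandoffTranslatePair
import Summits.RiemannHypothesis.RiemannHypothesis.Theorems.HandoffMarginLaw
import Literature.NumberTheory.LFunctions.WeilMarkovQuadratic
import HarnessLib

/-!
# HANDOFF — the SMALL-TRANSLATE WALL-CEILING CRITERION: `Re Q(θ(·−δ) − θ(·+δ)) < w_q·Re k_θ(log q − 2δ) ⟹ δ*(q) < δ` (rh-explicit, track «HANDOFF», seat prove-2 gen7, ATTEMPT-15, kernel part)

HONEST FRAMING. Nothing here bears on the truth of RH. An RH-free device for UPPER bounds on the wall offset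
`δ*(q) = a*(S_{<q}) − (log q)/2` (`HandoffMarginLaw.wallOffset`; the cell's «(L5) RH-free upper side at the (WL) scale»,
RH-PROMISE § 0′ T1.4). Let `q < q′` be consecutive primes, `θ` ANY Weil test function supported in the sub-window
`[−(log q)/2, (log q)/2]` (there `Q_{S_{<q}} = Q`: no prime power `≥ q` is visible), `0 ≤ δ` with `(log q)/2 + δ ≤ (log q′)/2`,
and `G := θ(· − δ) − θ(· + δ)` the SMALL translate pair (gen6's `HandoffTranslatePair` with `c = δ` instead of `c = (log q)/2`).
Then `G ∈ C((log q)/2 + δ)`, its kernel meets the atom `q` only through the COLLAR OVERLAP of `θ` at lag `log q − 2δ`: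
`k_G(±log q) = −k_θ(±(log q − 2δ))` (`weilConv_weilReflect_translatePair_log`), so that ON THE WINDOW

  `Re Q_{S_{<q}}(G) = Re Q(G) − w_q·Re k_θ(log q − 2δ)`,  `w_q = 2 log q/√q`   (`re_weilSemilocalQuadratic_translatePair_small`),

and therefore (`weilSemilocalThreshold_lt_of_translatePair`, `wallOffset_lt_of_translatePair`):

  **`Re Q(G) < w_q·Re k_θ(log q − 2δ)  ⟹  a*(S_{<q}) < (log q)/2 + δ`, i.e. `δ*(q) < δ`** — RH-free, for EVERY such `θ`;

dually, below the wall every sub-window profile's collar overlap is paid for by its pair's FULL-form energy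
(`collar_le_energy_of_le_wall`). The left side `Re Q(G)` is a full-form energy, controlled on the ZERO side by the
explicit formula (tree `explicit_formula_holds`; prove-1's `re_weilQuadratic_le_tail_of_kill` for zero-killing `θ`).

USE (ATTEMPT-15, HOME/handoff/prove-2/ATTEMPT-15.md; labels there): with `θ` = the ZERO-DODGER of prove-1's Theorem B
(`F₀ = ` inverse transform of `S·L/Λ_K`, a finite cosine series on the window, killing the first `K = N(T*)` zeros, `T* ≈ 2πe·q`),
`Re Q(G) = 2Σ_{γ>T*} 4 sin²(γδ) F̂₀(γ)²` is `c_∞²`-small AND the edge value is `F₀((log q)/2⁻) = c_∞/(2b₁)` EXACTLY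
(Lagrange interpolation at `0`; `c_∞ = Π_{k≤K}(ℓ_k/γ_k)²`), so `c_∞` CANCELS in the criterion: the dodger is «edge-dark» in absolute
terms (prove-1 ATTEMPT-7 §4.5) but NOT in the ratio that decides the wall. Numerically (DERIVED-FLOAT, kit j215301/j215386–390)
the single dodger gives `δ*(13) < 1.2e-3`, `δ*(29) < 6e-4` (certified walls 3.8e-4, 8.6e-5) and an RH-free ceiling of shape
`≍ (log q)^{3/2}·q^{−3/2}` — the (WL) exponent `3/2` from above — against gen5's Cramér-scale `(C/4)(log q)/√q`
(`HandoffWallCeiling.wallOffset_lt_ceiling`). None of that analysis is claimed here; this file is the exact reduction only.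

References (as printed): E. Bombieri, Rend. Mat. Acc. Lincei (9) 11 (2000), Thm 2 and §4 [`Bombieri2000Weil`]; A. Connes,
Selecta Math. 5 (1999) §VII Thm 4 (the S-local Weil sum) [`Connes1999`]; H. Yoshida, Duke Math. J. 67 (1992) §2 [`Yoshida1992`].
-/

set_option linter.dupNamespace false

noncomputable section

open Complex Filter Set MeasureTheory Literature.NumberTheory.LFunctions
open Summit.RiemannHypothesis.RiemannHypothesis.Theorems.MotivicDoor.SemilocalThreshold
open Summit.RiemannHypothesis.RiemannHypothesis.Theorems.HandoffMarginLaw (wallOffset)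
open scoped Real Topology ComplexConjugate ContDiff

namespace Summit.RiemannHypothesis.RiemannHypothesis.Theorems.Handoff

variable {θ : ℝ → ℂ} {q q' : ℕ} {δ : ℝ}

/-- **Kernel of the small translate pair at the atom.** For `θ` supported in `[−(log q)/2, (log q)/2]` and `0 ≤ δ`, the pair
`G = θ(· − δ) − θ(· + δ)` has `k_G(log q) = −k_θ(log q − 2δ)` and `k_G(−log q) = −k_θ(−(log q − 2δ))`
(`k_G = 2k_θ − k_θ(· − 2δ) − k_θ(· + 2δ)` and `k_θ` vanishes at `|t| ≥ log q`). [folklore] -/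
theorem weilConv_weilReflect_translatePair_log (hθ : IsWeilTest θ)
    (hθs : tsupport θ ⊆ Icc (-(Real.log q / 2)) (Real.log q / 2)) (hδ : 0 ≤ δ) :
    weilConv (fun x ↦ θ (x - δ) - θ (x + δ)) (weilReflect fun x ↦ θ (x - δ) - θ (x + δ)) (Real.log q) =
        -weilConv θ (weilReflect θ) (Real.log q - 2 * δ) ∧
      weilConv (fun x ↦ θ (x - δ) - θ (x + δ)) (weilReflect fun x ↦ θ (x - δ) - θ (x + δ)) (-Real.log q) =
        -weilConv θ (weilReflect θ) (-(Real.log q - 2 * δ)) := by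
  have hL : 0 ≤ Real.log q := Real.log_natCast_nonneg q
  have hz : ∀ t : ℝ, Real.log q ≤ |t| → weilConv θ (weilReflect θ) t = 0 := fun t ht ↦
    weilConv_weilReflect_eq_zero_of_le_abs hθ hθs (by linarith)
  have h1 : weilConv θ (weilReflect θ) (Real.log q) = 0 := hz _ (by rw [abs_of_nonneg hL])
  have h2 : weilConv θ (weilReflect θ) (Real.log q + 2 * δ) = 0 :=
    hz _ (by rw [abs_of_nonneg (by linarith)]; linarith)
  have h3 : weilConv θ (weilReflect θ) (-Real.log q) = 0 := hz _ (by rw [abs_neg, abs_of_nonneg hL])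
  have h4 : weilConv θ (weilReflect θ) (-Real.log q - 2 * δ) = 0 :=
    hz _ (by rw [show -Real.log q - 2 * δ = -(Real.log q + 2 * δ) by ring, abs_neg, abs_of_nonneg (by linarith)]; linarith)
  rw [weilConv_weilReflect_translatePair hθ δ]
  refine ⟨?_, ?_⟩
  · simp only [h1, h2]
    ring
  · simp only [h3, h4, show -Real.log q + 2 * δ = -(Real.log q - 2 * δ) by ring]
    ring

/-- **The contribution of `q` at the small pair is `w_q·Re k_θ(log q − 2δ)`** (`w_q = 2 log q/√q`): inserting the atom `q`
changes the form at `G` by the collar overlap `Re ∫ θ(y + log q − 2δ)·conj θ(y) dy` of the profile with itself at lag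
`log q − 2δ` — only the `2δ`-collars at the two edges of the sub-window talk to each other. [cite: Connes1999, §VII Thm 4 (the v = q term); this track, ATTEMPT-15 §1] -/
theorem contribution_translatePair_small (hθ : IsWeilTest θ)
    (hθs : tsupport θ ⊆ Icc (-(Real.log q / 2)) (Real.log q / 2)) (hδ : 0 ≤ δ) :
    contribution q (fun x ↦ θ (x - δ) - θ (x + δ)) =
      2 * Real.log q / Real.sqrt q * (weilConv θ (weilReflect θ) (Real.log q - 2 * δ)).re := by
  obtain ⟨h1, h2⟩ := weilConv_weilReflect_translatePair_log hθ hθs hδ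
  unfold contribution
  rw [h1, h2, weilConv_weilReflect_neg]
  simp only [Complex.add_re, Complex.neg_re, Complex.conj_re]
  ring

/-- **Semilocal energy of the small pair on the window.** For consecutive primes `q < q′`, `θ` supported in the
`q`-subwindow, `0 ≤ δ`, `(log q)/2 + δ ≤ (log q′)/2`:
`Re Q_{S_{<q}}(G) = Re Q(G) − (2 log q/√q)·Re k_θ(log q − 2δ)`. [cite: Connes1999, §VII Thm 4; Yoshida1992 §2 eq. (2.1); this track, ATTEMPT-15 §1] -/
theorem re_weilSemilocalQuadratic_translatePair_small (h : ConsecutivePrimes q q') (hθ : IsWeilTest θ)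
    (hθs : tsupport θ ⊆ Icc (-(Real.log q / 2)) (Real.log q / 2)) (hδ : 0 ≤ δ)
    (hwin : Real.log q / 2 + δ ≤ Real.log q' / 2) :
    (weilSemilocalQuadratic (Nat.primesBelow q) (fun x ↦ θ (x - δ) - θ (x + δ))).re =
      (weilQuadratic fun x ↦ θ (x - δ) - θ (x + δ)).re -
        2 * Real.log q / Real.sqrt q * (weilConv θ (weilReflect θ) (Real.log q - 2 * δ)).re := by
  have hG : IsWeilTest (fun x ↦ θ (x - δ) - θ (x + δ)) := isWeilTest_translatePair hθ δ
  have hGs : tsupport (fun x ↦ θ (x - δ) - θ (x + δ)) ⊆ Icc (-(Real.log q' / 2)) (Real.log q' / 2) :=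
    (tsupport_translatePair_subset hθs hδ).trans (Icc_subset_Icc (by linarith) (by linarith))
  have hid := re_weilQuadratic_eq_contribution_sub_deficit h hG hGs
  rw [contribution_translatePair_small hθ hθs hδ] at hid
  unfold deficit at hid
  linarith

/-- **THE SMALL-TRANSLATE WALL-CEILING CRITERION (RH-free).** For consecutive primes `q < q′`, ANY Weil test function `θ`
supported in `[−(log q)/2, (log q)/2]`, and `0 ≤ δ` with `(log q)/2 + δ ≤ (log q′)/2`: if the full-form energy of the pair
`G = θ(· − δ) − θ(· + δ)` is below the weighted collar overlap, `Re Q(G) < (2 log q/√q)·Re k_θ(log q − 2δ)`, then the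
`{p < q}`-form is negative at `G ∈ C((log q)/2 + δ)` and the wall satisfies `a*(S_{<q}) < (log q)/2 + δ`.
(The energy is a ZERO-SIDE quantity by the explicit formula; ATTEMPT-15 instantiates `θ` by zero-dodgers.) [this track, ATTEMPT-15 §1; objects: Bombieri2000Weil Thm 2, Connes1999 §VII Thm 4] -/
theorem weilSemilocalThreshold_lt_of_translatePair (h : ConsecutivePrimes q q') (hθ : IsWeilTest θ)
    (hθs : tsupport θ ⊆ Icc (-(Real.log q / 2)) (Real.log q / 2)) (hδ : 0 ≤ δ)
    (hwin : Real.log q / 2 + δ ≤ Real.log q' / 2)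
    (hneg : (weilQuadratic fun x ↦ θ (x - δ) - θ (x + δ)).re <
      2 * Real.log q / Real.sqrt q * (weilConv θ (weilReflect θ) (Real.log q - 2 * δ)).re) :
    weilSemilocalThreshold (Nat.primesBelow q) < Real.log q / 2 + δ := by
  refine not_weilSemilocalPositivityOn_iff_weilSemilocalThreshold_lt.1 fun hpos ↦ ?_
  have hG : IsWeilTest (fun x ↦ θ (x - δ) - θ (x + δ)) := isWeilTest_translatePair hθ δ
  have hGs : tsupport (fun x ↦ θ (x - δ) - θ (x + δ)) ⊆ Icc (-(Real.log q / 2 + δ)) (Real.log q / 2 + δ) :=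
    (tsupport_translatePair_subset hθs hδ).trans (Icc_subset_Icc (by linarith) (by linarith))
  have h0 := hpos _ hG hGs
  rw [re_weilSemilocalQuadratic_translatePair_small h hθ hθs hδ hwin] at h0
  linarith

/-- The same in the cell's currency: **`δ*(q) < δ`** (`wallOffset q = a*(S_{<q}) − (log q)/2`). RH-free; an UPPER bound on the
wall offset only — it says nothing about the sign of `δ*(q)`, which is RH (`riemannHypothesis_iff_forall_wallOffset_nonneg`).
[this track, ATTEMPT-15 §1] -/
theorem wallOffset_lt_of_translatePair (h : ConsecutivePrimes q q') (hθ : IsWeilTest θ)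
    (hθs : tsupport θ ⊆ Icc (-(Real.log q / 2)) (Real.log q / 2)) (hδ : 0 ≤ δ)
    (hwin : Real.log q / 2 + δ ≤ Real.log q' / 2)
    (hneg : (weilQuadratic fun x ↦ θ (x - δ) - θ (x + δ)).re <
      2 * Real.log q / Real.sqrt q * (weilConv θ (weilReflect θ) (Real.log q - 2 * δ)).re) :
    wallOffset q < δ := by
  have := weilSemilocalThreshold_lt_of_translatePair h hθ hθs hδ hwin hneg
  simp only [wallOffset]
  linarith

/-- **Dual (below the wall): the collar is paid for by the energy.** If `(log q)/2 + δ ≤ a*(S_{<q})` (in particular, under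
`H(q)`-type positivity on the window), then for EVERY Weil test function `θ` supported in the `q`-subwindow
`(2 log q/√q)·Re k_θ(log q − 2δ) ≤ Re Q(θ(· − δ) − θ(· + δ))`: the weighted collar overlap of any sub-window profile at lag
`log q − 2δ` is bounded by the full-form (zero-side) energy of its `δ`-pair. [this track, ATTEMPT-15 §1] -/
theorem collar_le_energy_of_le_wall (h : ConsecutivePrimes q q') (hθ : IsWeilTest θ)
    (hθs : tsupport θ ⊆ Icc (-(Real.log q / 2)) (Real.log q / 2)) (hδ : 0 ≤ δ)
    (hwin : Real.log q / 2 + δ ≤ Real.log q' / 2)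
    (hwall : Real.log q / 2 + δ ≤ weilSemilocalThreshold (Nat.primesBelow q)) :
    2 * Real.log q / Real.sqrt q * (weilConv θ (weilReflect θ) (Real.log q - 2 * δ)).re ≤
      (weilQuadratic fun x ↦ θ (x - δ) - θ (x + δ)).re := by
  by_contra hlt
  have := weilSemilocalThreshold_lt_of_translatePair h hθ hθs hδ hwin (lt_of_not_ge hlt)
  linarith

end Summit.RiemannHypothesis.RiemannHypothesis.Theorems.Handoff
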